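import Mathlib
import HarnessLib
import Literature.Analysis.FluidPDE.ClassicalSolution
import Literature.Analysis.FluidPDE.LerayHopf
import Literature.Analysis.FluidPDE.TaoLocalisationHolds
import Literature.Analysis.FluidPDE.TaoFiniteEnergyLerayHopf
import Summits.NavierStokesRegularity.NavierStokesRegularity.Theorems.QuarterJoltSliceTestStatic
import Summits.NavierStokesRegularity.NavierStokesRegularity.Theorems.QuarterJoltTerminalPairingIncrement
import Summits.NavierStokesRegularity.NavierStokesRegularity.Theorems.QuarterJoltEnergyJumpLaw
import Summits.NavierStokesRegularity.NavierStokesRegularity.Theorems.CertifiedBlowupCertifiedBlowupAxisymBlowupEnergyDrain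

/-!
# Route QuarterJolt — crux `NoTerminalJolt` (stmt-NavierStokesRegularity-26463), LEAD line
# `regular_split` rev 5: SLICE TESTING, III — `∫⟪u(T), u(t)⟫ − ∫‖u(t)‖²` under the Type-I rate

Seat ns-ntj-p1 g4 (LEAD; `--supports 26463 --as helper`). Third file of the TYPE-I ENERGY EQUALITY
chain (`QuarterJoltSliceTestTransport` p638099 → `QuarterJoltSliceTestStatic` p638481 → THIS →
`QuarterJoltTypeIEnergyEquality`). Frame: `(u,p)` classical on `[0,T)` (`ν, T > 0`), Leray–Hopf on
`[0,T]` from a rapidly decaying datum; the momentum equation on `(t,T)` is tested against the frozen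
REGULAR slice `U = u(t)`; under the sup-norm rate `‖u(τ)‖_∞ ≤ C/√(T'−τ)` the transport term —
integrated by parts onto `u(t)` — contributes `∫ C(T'−τ)^{-1/2}‖u(τ)‖₂‖Du(t)‖₂ dτ`, integrable up to
`T' = T`.
* `sliceTest_increment_abs_le_slab` — on a closed slab `[0,S]` in Tao's class (polarisation + the
  tree's `L²` balance as in `pair_increment_abs_le_slab`, p635010; integrand bounded by
  `sliceTest_abs_le_of_classical`; rate integrated by `EnergyDrain.lintegral_div_sqrt_sub_eq`):
  `|∫⟪u(s),u(t)⟫ − ∫‖u(t)‖²| ≤ (ν/2)η∫ₜˢ∫|Du|²_F + (ν/2)η⁻¹Z(s−t) + √I₀√Z·2C(√(T'−t) − √(T'−s))`,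
  `Z = ∫|Du(t)|²_F`, every `η > 0`.
* `sliceTest_terminal_abs_le` — in the frame (`I₀ = 2E(u 0)`; slab `[0,(s+T)/2]` by
  `tao2011_hasBoundedSobolevNormsOn_holds`; `s ↑ T` by weak continuity, test field `u(t)`):
  `|∫⟪u(T),u(t)⟫ − ∫‖u(t)‖²| ≤ (ν/2)η∫ₜᵀ∫|Du|²_F + (ν/2)η⁻¹Z(T−t) + √(2E₀)√Z·2C√(T−t)`.

HONEST FRAMING: a priori estimates under a (hypothetical) Type-I rate; nothing here concerns the
truth of `NoTerminalJolt` or Navier–Stokes regularity. No summit statement is proved here. [folklore]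
-/

noncomputable section

-- the summit and its single sub-problem share the name (CONVENTIONS §1), as in every Theorems file
set_option linter.dupNamespace false

namespace Summit.NavierStokesRegularity.NavierStokesRegularity.Theorems

open MeasureTheory Set Function Filter Topology InnerProductSpace
open scoped ENNReal NNReal ContDiff RealInnerProductSpace
open Literature.Analysis.FluidPDE

namespace NoTerminalJolt

/-! ### The slice-test increment on a closed slab -/

/-- **The slice-test increment on a closed slab** (`(u,p)` classical on `[0,S]×ℝ³` in Tao's class,
`∫‖u(τ)‖² ≤ I₀`, `0 < t < s < S`, rate `‖u(τ,x)‖ ≤ C/√(T'−τ)` on `(t,s)`, `s ≤ T'`, `C ≥ 0`; `η > 0`):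
`|∫⟪u(s),u(t)⟫ − ∫‖u(t)‖²| ≤ (ν/2)η(∫⁻_{(t,s)}∫⁻|Du|²_F).toReal + (ν/2)η⁻¹Z(s−t) + √I₀√Z·2C(√(T'−t)−√(T'−s))`,
`Z = ∫|Du(t)|²_F`. [folklore] -/
theorem sliceTest_increment_abs_le_slab {ν S : ℝ} (hν : 0 < ν) (hS : 0 < S)
    {u : ℝ → EuclideanSpace ℝ (Fin 3) → EuclideanSpace ℝ (Fin 3)} {p : ℝ → EuclideanSpace ℝ (Fin 3) → ℝ}
    (hsol : IsClassicalNSSolutionOn (Icc 0 S) ν 0 u p) (hB : HasBoundedSobolevNormsOn (Icc 0 S) u)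
    {I₀ : ℝ} (hI₀le : ∀ τ ∈ Icc 0 S, ∫ x, ‖u τ x‖ ^ 2 ≤ I₀)
    {t s : ℝ} (ht : 0 < t) (hts : t < s) (hsS : s < S)
    {T' C : ℝ} (hsT' : s ≤ T') (hC : 0 ≤ C)
    (hTI : ∀ τ ∈ Ioo t s, ∀ x, ‖u τ x‖ ≤ C / Real.sqrt (T' - τ)) {η : ℝ} (hη : 0 < η) :
    |(∫ x, ⟪u s x, u t x⟫) - ∫ x, ‖u t x‖ ^ 2| ≤
      ν / 2 * η *
          (∫⁻ τ in Ioo t s, ∫⁻ x, ENNReal.ofReal (frobeniusNormSq (fderiv ℝ (u τ) x))).toReal +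
        ν / 2 * η⁻¹ * (∫ x, frobeniusNormSq (fderiv ℝ (u t) x)) * (s - t) +
        Real.sqrt I₀ * Real.sqrt (∫ x, frobeniusNormSq (fderiv ℝ (u t) x)) *
          (2 * C * (Real.sqrt (T' - t) - Real.sqrt (T' - s))) := by
  have hUI : UniqueDiffOn ℝ (Icc 0 S) := uniqueDiffOn_Icc hS
  have hu : ∀ τ ∈ Icc 0 S, ContDiff ℝ ∞ (u τ) := fun τ hτ => hsol.contDiff_velocity hτ
  have htI : t ∈ Ioc 0 S := ⟨ht, (hts.trans hsS).le⟩
  have htI' : t ∈ Icc 0 S := ⟨ht.le, htI.2⟩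
  have hsI : s ∈ Ioc 0 S := ⟨ht.trans hts, hsS.le⟩
  set U : EuclideanSpace ℝ (Fin 3) → EuclideanSpace ℝ (Fin 3) := u t with hUdef
  have hUs : ContDiff ℝ ∞ U := hu t htI'
  have hU1 : ContDiff ℝ 1 U := hUs.of_le (by norm_cast)
  have cU : Continuous U := hUs.continuous
  have hdivU : VectorCalculus.IsDivFree U := hsol.divFree t htI'
  obtain ⟨C₀, hC₀⟩ := hB 0
  obtain ⟨C₁, hC₁⟩ := hB 1
  have hzero : ∀ σ ∈ Icc 0 S, ∫⁻ x, ‖u σ x‖ₑ ^ 2 ≤ C₀ := fun σ hσ => by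
    refine (le_of_eq (lintegral_congr fun x => ?_)).trans (hC₀ σ hσ)
    rw [← ofReal_norm, ← ofReal_norm, norm_iteratedFDeriv_zero]
  have l2sl : ∀ τ ∈ Icc 0 S, ∫⁻ x, ‖u τ x‖ₑ ^ 2 < ⊤ := fun τ hτ =>
    (hzero τ hτ).trans_lt ENNReal.coe_lt_top
  have cut : ∀ τ ∈ Icc 0 S, Continuous (u τ) := fun τ hτ => (hu τ hτ).continuous
  have hmu : ∀ τ ∈ Icc 0 S, MemLp (u τ) 2 volume := fun τ hτ =>
    memLp_two_of_lintegral_lt_top (cut τ hτ) (l2sl τ hτ)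
  have l2U : ∫⁻ x, ‖U x‖ₑ ^ 2 < ⊤ := l2sl t htI'
  have hmU : MemLp U 2 volume := hmu t htI'
  have l2DU : ∫⁻ x, ‖fderiv ℝ U x‖ₑ ^ 2 < ⊤ :=
    lintegral_enorm_sq_lt_top_of_norm_le (fun x => by
      rw [← norm_iteratedFDeriv_fderiv, norm_iteratedFDeriv_zero])
      ((hC₁ t htI').trans_lt ENNReal.coe_lt_top)
  obtain ⟨Λ, hΛtop, hΛ⟩ := hsol.exists_lintegral_enorm_timeDerivWithin_sq_le hν.le hS hB
  set W : ℝ → EuclideanSpace ℝ (Fin 3) → EuclideanSpace ℝ (Fin 3) := timeDerivWithin (Icc 0 S) u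
    with hWdef
  have hWsm : IsSmoothSpaceTimeOn (Icc 0 S) W := hsol.smooth_velocity.timeDerivWithin hUI
  have cWt : ∀ τ ∈ Icc 0 S, Continuous (W τ) := fun τ hτ => (hWsm.contDiff_slice hτ).continuous
  have l2Wt : ∀ τ ∈ Icc 0 S, ∫⁻ x, ‖W τ x‖ₑ ^ 2 < ⊤ := fun τ hτ => (hΛ τ hτ).trans_lt hΛtop.lt_top
  have hC₁u : ∀ τ ∈ Icc 0 S, ∫⁻ x, ‖timeDerivWithin (Icc 0 S) u τ x‖ₑ ^ 2 ≤ Λ.toNNReal := by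
    intro τ hτ; rw [ENNReal.coe_toNNReal hΛtop]; exact hΛ τ hτ
  obtain ⟨hΦu_int, -, hEu⟩ := hsol.smooth_velocity.l2_balance hS hzero hC₁u
  obtain ⟨w, hwdef⟩ : ∃ w : ℝ → EuclideanSpace ℝ (Fin 3) → EuclideanSpace ℝ (Fin 3),
      w = fun τ x => u τ x - U x := ⟨_, rfl⟩
  have hwtx : ∀ τ x, w τ x = u τ x - U x := fun τ x => by rw [hwdef]
  have hconst : IsSmoothSpaceTimeOn (Icc 0 S) (fun (_ : ℝ) (x : EuclideanSpace ℝ (Fin 3)) => U x) := by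
    have hc : ContDiff ℝ ∞ (uncurry fun (_ : ℝ) (x : EuclideanSpace ℝ (Fin 3)) => U x) :=
      hUs.comp contDiff_snd
    exact hc.contDiffOn
  have hwsm : IsSmoothSpaceTimeOn (Icc 0 S) w := by
    rw [hwdef]; exact hsol.smooth_velocity.sub hconst
  have hWt : ∀ τ ∈ Icc 0 S, ∀ x, timeDerivWithin (Icc 0 S) w τ x = W τ x := by
    intro τ hτ x
    rw [hwdef, hsol.smooth_velocity.timeDerivWithin_fun_sub hconst hUI hτ x]
    simp [hWdef, timeDerivWithin_apply]
  have hwL2 : ∀ τ ∈ Icc 0 S, ∫⁻ x, ‖w τ x‖ₑ ^ 2 ≤ (2 * C₀ + 2 * (∫⁻ x, ‖U x‖ₑ ^ 2).toNNReal : ℝ≥0) := by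
    intro τ hτ
    have h := lintegral_enorm_sq_sub_le (g := U) ((cut τ hτ).aestronglyMeasurable) (μ := volume)
    calc ∫⁻ x, ‖w τ x‖ₑ ^ 2 = ∫⁻ x, ‖u τ x - U x‖ₑ ^ 2 := lintegral_congr fun x => by rw [hwtx]
      _ ≤ 2 * (∫⁻ x, ‖u τ x‖ₑ ^ 2) + 2 * ∫⁻ x, ‖U x‖ₑ ^ 2 := h
      _ ≤ 2 * (C₀ : ℝ≥0∞) + 2 * ((∫⁻ x, ‖U x‖ₑ ^ 2).toNNReal : ℝ≥0∞) := by
          gcongr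
          · exact hzero τ hτ
          · exact le_of_eq (ENNReal.coe_toNNReal l2U.ne).symm
      _ = ((2 * C₀ + 2 * (∫⁻ x, ‖U x‖ₑ ^ 2).toNNReal : ℝ≥0) : ℝ≥0∞) := by push_cast; rfl
  have hWL2 : ∀ τ ∈ Icc 0 S, ∫⁻ x, ‖timeDerivWithin (Icc 0 S) w τ x‖ₑ ^ 2 ≤ Λ.toNNReal := by
    intro τ hτ
    rw [ENNReal.coe_toNNReal hΛtop]
    refine (le_of_eq (lintegral_congr fun x => ?_)).trans (hΛ τ hτ)
    rw [hWt τ hτ x]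
  obtain ⟨hΦw_int, -, hEw⟩ := hwsm.l2_balance hS hwL2 hWL2
  set Φu : ℝ → ℝ := fun τ => ∫ x, 2 * ⟪u τ x, timeDerivWithin (Icc 0 S) u τ x⟫ with hΦu
  set Φw : ℝ → ℝ := fun τ => ∫ x, 2 * ⟪w τ x, timeDerivWithin (Icc 0 S) w τ x⟫ with hΦw
  set Ψ : ℝ → ℝ := fun τ => (Φu τ - Φw τ) / 2 with hΨ
  set P : ℝ → ℝ := fun τ => ∫ x, ⟪u τ x, U x⟫ with hP
  have hΨ_int : IntegrableOn Ψ (Ioo 0 S) := (hΦu_int.sub hΦw_int).div_const 2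
  have hpol : ∀ τ ∈ Icc 0 S, P τ = ((∫ x, ‖u τ x‖ ^ 2) + (∫ x, ‖U x‖ ^ 2) - ∫ x, ‖w τ x‖ ^ 2) / 2 := by
    intro τ hτ
    have h := integral_norm_sub_sq_eq (hmu τ hτ) hmU
    have hw' : ∫ x, ‖w τ x‖ ^ 2 = ∫ x, ‖u τ x - U x‖ ^ 2 :=
      integral_congr_ae (Eventually.of_forall fun x => by simp only [hwtx])
    simp only [hP]
    rw [hw', h]
    ring
  have hincr : ∀ b ∈ Ioc 0 S, P b - P 0 = ∫ τ in (0 : ℝ)..b, Ψ τ := by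
    intro b hb
    have h0 : (0 : ℝ) ∈ Icc 0 S := ⟨le_rfl, hS.le⟩
    have hbI : b ∈ Icc 0 S := ⟨hb.1.le, hb.2⟩
    have e1 := hEu b hb
    have e2 := hEw b hb
    have hiu : IntervalIntegrable Φu volume 0 b :=
      (intervalIntegrable_iff_integrableOn_Ioo_of_le hb.1.le).2
        (hΦu_int.mono_set (Ioo_subset_Ioo le_rfl hb.2))
    have hiw : IntervalIntegrable Φw volume 0 b :=
      (intervalIntegrable_iff_integrableOn_Ioo_of_le hb.1.le).2
        (hΦw_int.mono_set (Ioo_subset_Ioo le_rfl hb.2))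
    have e3 : ∫ τ in (0 : ℝ)..b, Ψ τ = ((∫ τ in (0 : ℝ)..b, Φu τ) - ∫ τ in (0 : ℝ)..b, Φw τ) / 2 := by
      simp only [hΨ]
      rw [intervalIntegral.integral_div, intervalIntegral.integral_sub hiu hiw]
    rw [e3, hpol b hbI, hpol 0 h0]
    simp only [hΦu, hΦw] at e1 e2 ⊢
    linarith
  have hΨii : ∀ a b : ℝ, 0 ≤ a → b ≤ S → a ≤ b → IntervalIntegrable Ψ volume a b :=
    fun a b ha hb hab =>
      (intervalIntegrable_iff_integrableOn_Ioo_of_le hab).2 (hΨ_int.mono_set (Ioo_subset_Ioo ha hb))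
  have hPst : P s - P t = ∫ τ in Ioo t s, Ψ τ := by
    have h1 := hincr s hsI
    have h2 := hincr t htI
    have h3 := intervalIntegral.integral_interval_sub_left (hΨii 0 s le_rfl hsI.2 hsI.1.le)
      (hΨii 0 t le_rfl htI.2 htI.1.le)
    rw [intervalIntegral.integral_of_le hts.le, integral_Ioc_eq_integral_Ioo] at h3
    linarith
  have hΨeq : ∀ τ ∈ Icc 0 S, Ψ τ = ∫ x, ⟪U x, W τ x⟫ := by
    intro τ hτ
    have iu : Integrable (fun x => 2 * ⟪u τ x, timeDerivWithin (Icc 0 S) u τ x⟫) volume := by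
      refine (integrable_of_norm_le_mul_of_lintegral_sq ((cut τ hτ).inner (cWt τ hτ)).aestronglyMeasurable
        (cut τ hτ) (cWt τ hτ) (l2sl τ hτ) (l2Wt τ hτ) fun x => norm_inner_le_norm _ _).const_mul 2
    have cwt : Continuous (w τ) := (hwsm.contDiff_slice hτ).continuous
    have l2wt : ∫⁻ x, ‖w τ x‖ₑ ^ 2 < ⊤ := (hwL2 τ hτ).trans_lt ENNReal.coe_lt_top
    have iw : Integrable (fun x => 2 * ⟪w τ x, timeDerivWithin (Icc 0 S) w τ x⟫) volume := by
      have h1 : Integrable (fun x => ⟪w τ x, W τ x⟫) volume :=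
        integrable_of_norm_le_mul_of_lintegral_sq (cwt.inner (cWt τ hτ)).aestronglyMeasurable
          cwt (cWt τ hτ) l2wt (l2Wt τ hτ) fun x => norm_inner_le_norm _ _
      refine (h1.const_mul 2).congr (Eventually.of_forall fun x => ?_)
      simp only [hWt τ hτ x]
    simp only [hΨ, hΦu, hΦw]
    rw [← integral_sub iu iw]
    have hpt : (fun x => 2 * ⟪u τ x, timeDerivWithin (Icc 0 S) u τ x⟫ -
        2 * ⟪w τ x, timeDerivWithin (Icc 0 S) w τ x⟫) = fun x => 2 * ⟪U x, W τ x⟫ := by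
      funext x
      rw [hWt τ hτ x, hwtx, inner_sub_left, real_inner_comm (W τ x) (U x)]
      simp only [hWdef]
      ring
    rw [hpt, integral_const_mul]
    ring
  set ZU : ℝ := ∫ x, frobeniusNormSq (fderiv ℝ U x) with hZU
  set a : ℝ := ν / 2 * η with ha
  set K : ℝ := ν / 2 * η⁻¹ * ZU with hK
  set A : ℝ := C * (Real.sqrt I₀ * Real.sqrt ZU) with hA
  set F : ℝ → ℝ≥0∞ := fun τ => ∫⁻ x, ENNReal.ofReal (frobeniusNormSq (fderiv ℝ (u τ) x)) with hF
  have ha0 : 0 ≤ a := by rw [ha]; positivity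
  have hZU0 : 0 ≤ ZU := integral_nonneg fun x => frobeniusNormSq_nonneg _
  have hK0 : 0 ≤ K := by rw [hK]; positivity
  have hA0 : 0 ≤ A := by rw [hA]; positivity
  have hbound : ∀ τ ∈ Ioo t s, ENNReal.ofReal ‖Ψ τ‖ ≤
      ENNReal.ofReal a * F τ + ENNReal.ofReal K + ENNReal.ofReal (A / Real.sqrt (T' - τ)) := by
    intro τ hτ
    have hτS : τ ∈ Ioo 0 S := ⟨ht.trans hτ.1, hτ.2.trans hsS⟩
    have hτS' : τ ∈ Icc 0 S := Ioo_subset_Icc_self hτS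
    have hest := sliceTest_abs_le_of_classical hν hS hsol hB hI₀le hτS (hTI τ hτ) hU1 hdivU l2U
      l2DU hη
    rw [← hΨeq τ hτS'] at hest
    have hGeq : ∫ x, frobeniusNormSq (fderiv ℝ (u τ) x) = (F τ).toReal :=
      integral_eq_lintegral_of_nonneg_ae (Eventually.of_forall fun x => frobeniusNormSq_nonneg _)
        (continuous_frobeniusNormSq_fderiv (hu τ hτS') (by simp)).aestronglyMeasurable
    have hFfin : F τ ≠ ⊤ := by
      refine (lt_of_le_of_lt ?_ (ENNReal.mul_lt_top (by norm_num : (3 : ℝ≥0∞) < ⊤)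
        ((hC₁ τ hτS').trans_lt ENNReal.coe_lt_top))).ne
      calc F τ ≤ ∫⁻ x, 3 * ‖fderiv ℝ (u τ) x‖ₑ ^ 2 :=
            lintegral_mono fun x => ofReal_frobeniusNormSq_le_three_mul_enorm_sq _
        _ = 3 * ∫⁻ x, ‖fderiv ℝ (u τ) x‖ₑ ^ 2 := lintegral_const_mul' _ _ (by norm_num)
        _ = 3 * ∫⁻ x, ‖iteratedFDeriv ℝ 1 (u τ) x‖ₑ ^ 2 := by
            congr 1
            exact lintegral_congr fun x => by
              rw [← ofReal_norm, ← ofReal_norm, ← norm_iteratedFDeriv_fderiv, norm_iteratedFDeriv_zero]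
    have hsq0 : 0 ≤ Real.sqrt (T' - τ) := Real.sqrt_nonneg _
    have hdiv0 : 0 ≤ A / Real.sqrt (T' - τ) := div_nonneg hA0 hsq0
    have halg : ν / 2 * (η * (F τ).toReal + η⁻¹ * ZU) +
        C / Real.sqrt (T' - τ) * (Real.sqrt I₀ * Real.sqrt ZU) =
        a * (F τ).toReal + K + A / Real.sqrt (T' - τ) := by
      rw [ha, hK, hA]; ring
    rw [Real.norm_eq_abs]
    calc ENNReal.ofReal |Ψ τ|
        ≤ ENNReal.ofReal (a * (F τ).toReal + K + A / Real.sqrt (T' - τ)) := by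
          refine ENNReal.ofReal_le_ofReal ?_
          rw [← halg, ← hGeq]
          exact hest
      _ = ENNReal.ofReal a * F τ + ENNReal.ofReal K + ENNReal.ofReal (A / Real.sqrt (T' - τ)) := by
          rw [ENNReal.ofReal_add (by positivity) hdiv0, ENNReal.ofReal_add (by positivity) hK0,
            ENNReal.ofReal_mul ha0, ENNReal.ofReal_toReal hFfin]
  -- integrate the bound over `(t,s)`
  have hrate := CertifiedBlowupAxisymBlowup.EnergyDrain.lintegral_div_sqrt_sub_eq hA0 hts hsT'
  have hlin : ∫⁻ τ in Ioo t s, ENNReal.ofReal ‖Ψ τ‖ ≤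
      ENNReal.ofReal a * (∫⁻ τ in Ioo t s, F τ) + ENNReal.ofReal K * ENNReal.ofReal (s - t) +
        ENNReal.ofReal (2 * A * (Real.sqrt (T' - t) - Real.sqrt (T' - s))) := by
    calc ∫⁻ τ in Ioo t s, ENNReal.ofReal ‖Ψ τ‖
        ≤ ∫⁻ τ in Ioo t s,
            (ENNReal.ofReal a * F τ + ENNReal.ofReal K + ENNReal.ofReal (A / Real.sqrt (T' - τ))) :=
          setLIntegral_mono' measurableSet_Ioo fun τ hτ => hbound τ hτ
      _ = ENNReal.ofReal a * (∫⁻ τ in Ioo t s, F τ) + ENNReal.ofReal K * ENNReal.ofReal (s - t) +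
            ∫⁻ τ in Ioo t s, ENNReal.ofReal (A / Real.sqrt (T' - τ)) := by
          have hm : Measurable fun τ => ENNReal.ofReal (A / Real.sqrt (T' - τ)) :=
            (measurable_const.div (measurable_const.sub measurable_id).sqrt).ennreal_ofReal
          rw [lintegral_add_right _ hm, lintegral_add_right _ measurable_const,
            lintegral_const_mul' _ _ ENNReal.ofReal_ne_top,
            lintegral_const, Measure.restrict_apply MeasurableSet.univ, univ_inter, Real.volume_Ioo]
      _ = _ := by rw [hrate]
  have hDfin : (∫⁻ τ in Ioo t s, F τ) ≠ ⊤ := by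
    have hle : ∀ τ ∈ Ioo t s, F τ ≤ 3 * (C₁ : ℝ≥0∞) := by
      intro τ hτ
      have hτS' : τ ∈ Icc 0 S := ⟨(ht.trans hτ.1).le, (hτ.2.trans hsS).le⟩
      calc F τ ≤ ∫⁻ x, 3 * ‖fderiv ℝ (u τ) x‖ₑ ^ 2 :=
            lintegral_mono fun x => ofReal_frobeniusNormSq_le_three_mul_enorm_sq _
        _ = 3 * ∫⁻ x, ‖fderiv ℝ (u τ) x‖ₑ ^ 2 := lintegral_const_mul' _ _ (by norm_num)
        _ ≤ 3 * (C₁ : ℝ≥0∞) := by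
            refine mul_le_mul' le_rfl ((le_of_eq (lintegral_congr fun x => ?_)).trans (hC₁ τ hτS'))
            rw [← ofReal_norm, ← ofReal_norm, ← norm_iteratedFDeriv_fderiv, norm_iteratedFDeriv_zero]
    refine (lt_of_le_of_lt (setLIntegral_mono' measurableSet_Ioo fun τ hτ => hle τ hτ) ?_).ne
    rw [lintegral_const, Measure.restrict_apply MeasurableSet.univ, univ_inter, Real.volume_Ioo]
    exact ENNReal.mul_lt_top (ENNReal.mul_lt_top (by norm_num) ENNReal.coe_lt_top) ENNReal.ofReal_lt_top
  -- conclude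
  have hnorm := norm_integral_le_lintegral_norm (μ := volume.restrict (Ioo t s)) Ψ
  rw [Real.norm_eq_abs] at hnorm
  have hrate0 : 0 ≤ 2 * A * (Real.sqrt (T' - t) - Real.sqrt (T' - s)) := by
    have : Real.sqrt (T' - s) ≤ Real.sqrt (T' - t) := Real.sqrt_le_sqrt (by linarith)
    have : 0 ≤ Real.sqrt (T' - t) - Real.sqrt (T' - s) := by linarith
    positivity
  have hfinR : ENNReal.ofReal a * (∫⁻ τ in Ioo t s, F τ) + ENNReal.ofReal K * ENNReal.ofReal (s - t) +
      ENNReal.ofReal (2 * A * (Real.sqrt (T' - t) - Real.sqrt (T' - s))) ≠ ⊤ :=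
    ENNReal.add_ne_top.2 ⟨ENNReal.add_ne_top.2 ⟨ENNReal.mul_ne_top ENNReal.ofReal_ne_top hDfin,
      ENNReal.mul_ne_top ENNReal.ofReal_ne_top ENNReal.ofReal_ne_top⟩, ENNReal.ofReal_ne_top⟩
  have htoReal : (∫⁻ τ in Ioo t s, ENNReal.ofReal ‖Ψ τ‖).toReal ≤
      a * (∫⁻ τ in Ioo t s, F τ).toReal + K * (s - t) +
        2 * A * (Real.sqrt (T' - t) - Real.sqrt (T' - s)) := by
    have h := (ENNReal.toReal_le_toReal (ne_top_of_le_ne_top hfinR hlin) hfinR).2 hlin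
    rw [ENNReal.toReal_add (ENNReal.add_ne_top.2 ⟨ENNReal.mul_ne_top ENNReal.ofReal_ne_top hDfin,
        ENNReal.mul_ne_top ENNReal.ofReal_ne_top ENNReal.ofReal_ne_top⟩) ENNReal.ofReal_ne_top,
      ENNReal.toReal_add (ENNReal.mul_ne_top ENNReal.ofReal_ne_top hDfin)
        (ENNReal.mul_ne_top ENNReal.ofReal_ne_top ENNReal.ofReal_ne_top), ENNReal.toReal_mul,
      ENNReal.toReal_mul, ENNReal.toReal_ofReal ha0, ENNReal.toReal_ofReal hK0,
      ENNReal.toReal_ofReal (by linarith), ENNReal.toReal_ofReal hrate0] at h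
    exact h
  -- `P t = ∫‖u t‖²`
  have hPt : P t = ∫ x, ‖u t x‖ ^ 2 := by
    simp only [hP, hUdef]
    exact integral_congr_ae (Eventually.of_forall fun x => real_inner_self_eq_norm_sq _)
  have hgoal : (∫ x, ⟪u s x, u t x⟫) - ∫ x, ‖u t x‖ ^ 2 = P s - P t := by
    rw [hPt]
  rw [hgoal, hPst]
  refine (hnorm.trans htoReal).trans (le_of_eq ?_)
  simp only [ha, hK, hA, hZU]
  ring

/-! ### In the frame: slice testing up to the terminal time under the Type-I rate -/

/-- **The slice-test increment up to the terminal time under the Type-I rate** (frame: classical on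
`[0,T)`, Leray–Hopf on `[0,T]`, rapidly decaying datum; `t ∈ (0,T)`, `‖u(τ,x)‖ ≤ C/√(T−τ)` on `(t,T)`,
`C ≥ 0`; `η > 0`; `Z = ∫|Du(t)|²_F`, `E₀ = E(u 0)`):
`|∫⟪u(T),u(t)⟫ − ∫‖u(t)‖²| ≤ (ν/2)η(∫⁻_{(t,T)}∫⁻|Du|²_F).toReal + (ν/2)η⁻¹Z(T−t) + √(2E₀)√Z·2C√(T−t)`.
[folklore] -/
theorem sliceTest_terminal_abs_le {ν T : ℝ} (hν : 0 < ν) (hT : 0 < T)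
    {u : ℝ → EuclideanSpace ℝ (Fin 3) → EuclideanSpace ℝ (Fin 3)} {p : ℝ → EuclideanSpace ℝ (Fin 3) → ℝ}
    (hcl : IsClassicalNSSolutionOn (Ico 0 T) ν 0 u p) (hLH : IsLerayHopfOn T ν 0 (u 0) u)
    (hdec : HasRapidSpatialDecay (u 0))
    {C : ℝ} (hC : 0 ≤ C) {t : ℝ} (ht : t ∈ Ioo 0 T)
    (hTI : ∀ τ ∈ Ioo t T, ∀ x, ‖u τ x‖ ≤ C / Real.sqrt (T - τ)) {η : ℝ} (hη : 0 < η) :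
    |(∫ x, ⟪u T x, u t x⟫) - ∫ x, ‖u t x‖ ^ 2| ≤
      ν / 2 * η *
          (∫⁻ τ in Ioo t T, ∫⁻ x, ENNReal.ofReal (frobeniusNormSq (fderiv ℝ (u τ) x))).toReal +
        ν / 2 * η⁻¹ * (∫ x, frobeniusNormSq (fderiv ℝ (u t) x)) * (T - t) +
        Real.sqrt (2 * VectorCalculus.kineticEnergy (u 0)) *
          Real.sqrt (∫ x, frobeniusNormSq (fderiv ℝ (u t) x)) * (2 * C * Real.sqrt (T - t)) := by
  have hmt : MemLp (u t) 2 volume := hLH.memLp t ⟨ht.1.le, ht.2.le⟩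
  set I₀ : ℝ := 2 * VectorCalculus.kineticEnergy (u 0) with hI₀
  have hI₀le : ∀ τ ∈ Icc 0 T, ∫ x, ‖u τ x‖ ^ 2 ≤ I₀ := by
    intro τ hτ
    have h := CertifiedBlowupAxisymBlowup.EnergyDrain.kineticEnergy_antitoneOn hν hcl hLH
      ⟨le_rfl, hT.le⟩ hτ hτ.1
    have h2 : ∫ x, ‖u τ x‖ ^ 2 = 2 * VectorCalculus.kineticEnergy (u τ) := by
      simp only [VectorCalculus.kineticEnergy]; ring
    rw [h2, hI₀]
    simp only at h
    linarith
  set Z : ℝ := ∫ x, frobeniusNormSq (fderiv ℝ (u t) x) with hZ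
  have hZ0 : 0 ≤ Z := integral_nonneg fun x => frobeniusNormSq_nonneg _
  set D : ℝ≥0∞ := ∫⁻ τ in Ioo t T, ∫⁻ x, ENNReal.ofReal (frobeniusNormSq (fderiv ℝ (u τ) x)) with hD
  have hDfin : D ≠ ⊤ :=
    (CertifiedBlowupAxisymBlowup.EnergyDrain.dissipation_le_energy_sub hν hcl hLH ht.1.le
      ht.2.le le_rfl).1
  set R : ℝ := ν / 2 * η * D.toReal + ν / 2 * η⁻¹ * Z * (T - t) +
    Real.sqrt I₀ * Real.sqrt Z * (2 * C * Real.sqrt (T - t)) with hR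
  -- the increment bound for every `s ∈ (t, T)`
  have hincr : ∀ s ∈ Ioo t T, |(∫ x, ⟪u s x, u t x⟫) - ∫ x, ‖u t x‖ ^ 2| ≤ R := by
    intro s hs
    set S : ℝ := (s + T) / 2 with hSdef
    have hsS : s < S := by rw [hSdef]; linarith [hs.2]
    have hST : S < T := by rw [hSdef]; linarith [hs.2]
    have hS : 0 < S := (ht.1.trans hs.1).trans hsS
    have hsolS : IsClassicalNSSolutionOn (Icc 0 S) ν 0 u p :=
      hcl.mono (Icc_subset_Ico_right hST) (uniqueDiffOn_Icc hS)
    have hE' : ∃ C' : ℝ≥0, ∀ τ ∈ Icc 0 S, ∫⁻ x, ‖u τ x‖ₑ ^ 2 ≤ C' :=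
      ⟨(ENNReal.ofReal (2 * VectorCalculus.kineticEnergy (u 0))).toNNReal, fun τ hτ => by
        rw [ENNReal.coe_toNNReal ENNReal.ofReal_ne_top]
        exact hLH.lintegral_enorm_sq_le hν.le ⟨hτ.1, hτ.2.trans hST.le⟩⟩
    have hB : HasBoundedSobolevNormsOn (Icc 0 S) u :=
      tao2011_hasBoundedSobolevNormsOn_holds hν hS hsolS hE' hdec
    have hTI' : ∀ τ ∈ Ioo t s, ∀ x, ‖u τ x‖ ≤ C / Real.sqrt (T - τ) := fun τ hτ x =>
      hTI τ ⟨hτ.1, hτ.2.trans hs.2⟩ x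
    have h := sliceTest_increment_abs_le_slab hν hS hsolS hB
      (fun τ hτ => hI₀le τ ⟨hτ.1, hτ.2.trans hST.le⟩) ht.1 hs.1 hsS hs.2.le hC hTI' hη
    have hmono : (∫⁻ τ in Ioo t s, ∫⁻ x, ENNReal.ofReal (frobeniusNormSq (fderiv ℝ (u τ) x))).toReal ≤
        D.toReal :=
      ENNReal.toReal_mono hDfin (lintegral_mono_set (Ioo_subset_Ioo_right hs.2.le))
    have h1 : ν / 2 * η *
        (∫⁻ τ in Ioo t s, ∫⁻ x, ENNReal.ofReal (frobeniusNormSq (fderiv ℝ (u τ) x))).toReal ≤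
        ν / 2 * η * D.toReal := mul_le_mul_of_nonneg_left hmono (by positivity)
    have h2 : ν / 2 * η⁻¹ * Z * (s - t) ≤ ν / 2 * η⁻¹ * Z * (T - t) :=
      mul_le_mul_of_nonneg_left (by linarith [hs.2]) (by positivity)
    have h3 : Real.sqrt I₀ * Real.sqrt Z * (2 * C * (Real.sqrt (T - t) - Real.sqrt (T - s))) ≤
        Real.sqrt I₀ * Real.sqrt Z * (2 * C * Real.sqrt (T - t)) := by
      have : Real.sqrt (T - t) - Real.sqrt (T - s) ≤ Real.sqrt (T - t) := by
        linarith [Real.sqrt_nonneg (T - s)]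
      have h4 : 2 * C * (Real.sqrt (T - t) - Real.sqrt (T - s)) ≤ 2 * C * Real.sqrt (T - t) :=
        mul_le_mul_of_nonneg_left this (by positivity)
      exact mul_le_mul_of_nonneg_left h4 (by positivity)
    rw [hR]
    linarith
  -- pass to the limit `s ↑ T` (weak continuity of the Leray–Hopf structure, test field `u t`)
  have hle_filter : 𝓝[<] T ≤ 𝓝[Ioc 0 T] T := by
    rw [← nhdsWithin_Ioo_eq_nhdsLT hT]
    exact nhdsWithin_mono _ Ioo_subset_Ioc_self
  have hlim : Tendsto (fun s => (∫ x, ⟪u s x, u t x⟫) - ∫ x, ‖u t x‖ ^ 2) (𝓝[<] T)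
      (𝓝 ((∫ x, ⟪u T x, u t x⟫) - ∫ x, ‖u t x‖ ^ 2)) :=
    ((((hLH.weak_continuous (u t) hmt).1) T ⟨hT, le_rfl⟩).tendsto.mono_left hle_filter).sub
      tendsto_const_nhds
  have hev : ∀ᶠ s in 𝓝[<] T, |(∫ x, ⟪u s x, u t x⟫) - ∫ x, ‖u t x‖ ^ 2| ≤ R := by
    filter_upwards [Ioo_mem_nhdsLT ht.2] with s hs
    exact hincr s hs
  have hfinal := le_of_tendsto hlim.abs hev
  rw [hR] at hfinal
  exact hfinal

end NoTerminalJolt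

end Summit.NavierStokesRegularity.NavierStokesRegularity.Theorems

end
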